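import Mathlib.Topology.Algebra.OpenSubgroup
import Literature.NumberTheory.Automorphic.ParabolicGL
import Literature.NumberTheory.Automorphic.ReductiveGroupData
import HarnessLib

/-!
# Reduction mod `𝓂`, standard parahoric, Iwahori and pro-`p` Iwahori subgroups of `GL_n(F)`

Topic `NumberTheory/Automorphic`, namespace `Literature.Automorphic` (as `glInt`).  For a field `F` with
a `ValuativeRel` (valuation ring `𝒪 = 𝒪[F]`, maximal ideal `𝓂`, residue field `𝓀 = 𝓀[F]`) and
`K₀ = GL_n(𝒪) = glInt n F` (`ReductiveGroupData`), this file defines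

* `glIntEquiv n F : GL (Fin n) 𝒪[F] ≃* glInt n F` and the **reduction homomorphism**
  `glIntReduction n F : glInt n F →* GL (Fin n) 𝓀[F]`, `g ↦ ḡ = g mod 𝓂`;
* the **standard parahoric subgroup** `parahoricGL n F c ≤ GL_n(F)` of a block labelling
  `c : Fin n → α`: the preimage in `K₀` of the standard parabolic `P_c(𝓀)`
  (`Literature.NumberTheory.Automorphic.standardParabolicGL`, `ParabolicGL`), and its **pro-unipotent radical**
  `proUnipotentGL n F c`, the preimage of the unipotent radical `U_c(𝓀)`
  (`Literature.NumberTheory.Automorphic.unipotentRadicalGL`);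
* the **Iwahori subgroup** `iwahoriGL n F = parahoricGL n F id` (matrices in `K₀` that are upper
  triangular mod `𝓂`: "the full inverse image of a Borel subgroup … under the reduction (mod 𝔓)
  homomorphism", Iwahori–Matsumoto), the **pro-`p` Iwahori subgroup**
  `proPIwahoriGL n F = proUnipotentGL n F id` (upper unitriangular mod `𝓂`), and the normalizer
  `iwahoriNormalizerGL n F = N(F)` of the Iwahori subgroup in `GL_n(F)`.

Main statements (all proved): membership criteria in terms of valuations of entries
(`mem_parahoricGL_iff`, `mem_iwahoriGL_iff`, `mem_proPIwahoriGL_iff`), the inclusions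
`proUnipotentGL ≤ parahoricGL ≤ glInt`, normality of the pro-unipotent radical in the parahoric,
and, over a non-archimedean local field, that all these subgroups are open and compact.
Motivation: these are the subgroups `K = GL₂(𝒪_F) ⊇ I ⊇ I₁` and `N(F)` of the mod `p`
representation theory of `GL₂(F)` (Breuil, ICM 2010, §3.2: diagrams `(D₀, D₁)`, Theorem 3.4),
needed to decompose the barrier fact `Literature.Barriers.Langlands.ModPLanglandsGL2BeyondQp`.

## References

* N. Iwahori, H. Matsumoto, *On some Bruhat decomposition and the structure of the Hecke rings of
  p-adic Chevalley groups*, Publ. Math. IHÉS 25 (1965) 5–48, Introduction p. 6 and §2,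
  Prop. 2.4, Thm. 2.5 (`B` = inverse image of the Borel `B_k` of `G_k`, `k = 𝔒/𝔓`, under
  reduction mod `𝔓`; `B` open compact). [cite: IwahoriMatsumoto1965, §2 Prop. 2.4]
* C. Breuil, *The emerging p-adic Langlands programme*, Proc. ICM 2010, Vol. II, 203–230, §3.2
  (`I`, "the pro-`p` subgroup `I₁` of `I`", and "the normalizer `N(F)` of the Iwahori subgroup `I`
  inside `GL₂(F)`, that is, … generated by `I`, the scalars `F^×` and the matrix `(0 1; ϖ_F 0)`").
  [cite: Breuil2011, §3.2]
-/

open scoped ValuativeRel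
open ValuativeRel

universe u

namespace Literature.NumberTheory.Automorphic

/-! ### `GL_n(𝒪) ≃ glInt` and reduction modulo `𝓂` -/

section Reduction

variable (n : ℕ) (F : Type u) [Field F] [ValuativeRel F]

variable {n F} in
/-- Entries of elements of `GL_n(𝒪)` (`glInt`) are integral. [folklore] -/
theorem apply_mem_integer_of_mem_glInt {g : GL (Fin n) F} (hg : g ∈ glInt n F) (i j : Fin n) :
    (g : Matrix (Fin n) (Fin n) F) i j ∈ 𝒪[F] :=
  ((mem_glInt_iff g).mp hg).1 i j

variable {F} in
/-- An element of `𝒪` has residue `0` iff it lies in `𝓂`, iff its valuation is `< 1`. [folklore] -/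
theorem residue_eq_zero_iff_valuation_lt_one (x : 𝒪[F]) :
    IsLocalRing.residue 𝒪[F] x = 0 ↔ valuation F (x : F) < 1 := by
  rw [IsLocalRing.residue_eq_zero_iff, IsLocalRing.mem_maximalIdeal, mem_nonunits_iff,
    (Valuation.integer.integers (valuation F)).isUnit_iff_valuation_eq_one]
  exact ⟨fun h => lt_of_le_of_ne ((Valuation.mem_integer_iff _ _).mp x.2) h, fun h => h.ne⟩

/-- `GL_n` of an injective ring hom is injective. [folklore] -/
theorem generalLinearGroup_map_injective {R S : Type*} [CommRing R] [CommRing S] {m : Type*}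
    [Fintype m] [DecidableEq m] (f : R →+* S) (hf : Function.Injective f) :
    Function.Injective (Matrix.GeneralLinearGroup.map (n := m) f) := by
  intro g h hgh
  ext i j
  apply hf
  have := congrArg (fun u : GL m S => (u : Matrix m m S) i j) hgh
  simpa using this

/-- The isomorphism `GL_n(𝒪[F]) ≃* glInt n F` onto the subgroup of `GL_n(F)` of integral matrices
with integral inverse (`glInt` is by definition the range of `GL_n` of `𝒪[F] ↪ F`).
(Cartier, Corvallis 1979, §IV.1.) [folklore] -/
noncomputable def glIntEquiv : GL (Fin n) 𝒪[F] ≃* glInt n F :=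
  MonoidHom.ofInjective
    (generalLinearGroup_map_injective (𝒪[F]).subtype Subtype.val_injective)

variable {n F} in
/-- The entries of `glIntEquiv u` are the entries of `u`, viewed in `F`. [folklore] -/
@[simp] theorem coe_glIntEquiv_apply (u : GL (Fin n) 𝒪[F]) (i j : Fin n) :
    (((glIntEquiv n F u : glInt n F) : GL (Fin n) F) : Matrix (Fin n) (Fin n) F) i j =
      ((u : Matrix (Fin n) (Fin n) 𝒪[F]) i j : F) := rfl

variable {n F} in
/-- The entries of `(glIntEquiv)⁻¹ g`, viewed in `F`, are the entries of `g`. [folklore] -/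
@[simp] theorem coe_glIntEquiv_symm_apply (g : glInt n F) (i j : Fin n) :
    ((((glIntEquiv n F).symm g : GL (Fin n) 𝒪[F]) : Matrix (Fin n) (Fin n) 𝒪[F]) i j : F) =
      ((g : GL (Fin n) F) : Matrix (Fin n) (Fin n) F) i j := by
  have h := MonoidHom.apply_ofInjective_symm
    (generalLinearGroup_map_injective (m := Fin n) (𝒪[F]).subtype Subtype.val_injective) g
  have h' := congrArg (fun u : GL (Fin n) F => (u : Matrix (Fin n) (Fin n) F) i j) h
  rw [Matrix.GeneralLinearGroup.map_apply] at h'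
  exact h'

variable {n F} in
/-- The `(i, j)` entry of `(glIntEquiv)⁻¹ g` is the entry `g i j` with its integrality proof. [folklore] -/
theorem glIntEquiv_symm_apply_apply (g : glInt n F) (i j : Fin n) :
    (((glIntEquiv n F).symm g : GL (Fin n) 𝒪[F]) : Matrix (Fin n) (Fin n) 𝒪[F]) i j =
      ⟨((g : GL (Fin n) F) : Matrix (Fin n) (Fin n) F) i j,
        apply_mem_integer_of_mem_glInt g.2 i j⟩ :=
  Subtype.ext (coe_glIntEquiv_symm_apply g i j)

/-- **Reduction modulo `𝓂`**: the homomorphism `GL_n(𝒪) → GL_n(𝓀)`, `g ↦ ḡ`, on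
`glInt n F ≅ GL_n(𝒪[F])` (`GL_n` of the residue map `𝒪[F] → 𝓀[F]`).
(Iwahori–Matsumoto 1965, §2, "the reduction mod. 𝔓" homomorphism.) [folklore] -/
noncomputable def glIntReduction : glInt n F →* GL (Fin n) 𝓀[F] :=
  (Matrix.GeneralLinearGroup.map (IsLocalRing.residue 𝒪[F])).comp
    (glIntEquiv n F).symm.toMonoidHom

variable {n F} in
/-- The entries of `ḡ` are the residues of the entries of `g`. [folklore] -/
theorem coe_glIntReduction_apply (g : glInt n F) (i j : Fin n) :
    ((glIntReduction n F g : GL (Fin n) 𝓀[F]) : Matrix (Fin n) (Fin n) 𝓀[F]) i j =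
      IsLocalRing.residue 𝒪[F] ⟨((g : GL (Fin n) F) : Matrix (Fin n) (Fin n) F) i j,
        apply_mem_integer_of_mem_glInt g.2 i j⟩ := by
  simp only [glIntReduction, MonoidHom.coe_comp, MulEquiv.coe_toMonoidHom, Function.comp_apply,
    Matrix.GeneralLinearGroup.map_apply, glIntEquiv_symm_apply_apply]

variable {n F} in
/-- An entry of `ḡ` vanishes iff the corresponding entry of `g` has valuation `< 1`. [folklore] -/
theorem glIntReduction_apply_eq_zero_iff (g : glInt n F) (i j : Fin n) :
    ((glIntReduction n F g : GL (Fin n) 𝓀[F]) : Matrix (Fin n) (Fin n) 𝓀[F]) i j = 0 ↔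
      valuation F (((g : GL (Fin n) F) : Matrix (Fin n) (Fin n) F) i j) < 1 := by
  rw [coe_glIntReduction_apply, residue_eq_zero_iff_valuation_lt_one]

variable {n F} in
/-- An entry of `ḡ` equals `1` iff the corresponding entry of `g` is `≡ 1 mod 𝓂`. [folklore] -/
theorem glIntReduction_apply_eq_one_iff (g : glInt n F) (i j : Fin n) :
    ((glIntReduction n F g : GL (Fin n) 𝓀[F]) : Matrix (Fin n) (Fin n) 𝓀[F]) i j = 1 ↔
      valuation F (((g : GL (Fin n) F) : Matrix (Fin n) (Fin n) F) i j - 1) < 1 := by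
  rw [coe_glIntReduction_apply, ← sub_eq_zero, ← map_one (IsLocalRing.residue 𝒪[F]), ← map_sub,
    residue_eq_zero_iff_valuation_lt_one]
  rfl

end Reduction

/-! ### Standard parahoric subgroups and their pro-unipotent radicals -/

section Parahoric

variable (n : ℕ) (F : Type u) [Field F] [ValuativeRel F] {α : Type*} [LinearOrder α]
  (c : Fin n → α)

/-- The **standard parahoric subgroup** of `GL_n(F)` attached to a block labelling
`c : Fin n → α`: the elements of `K₀ = GL_n(𝒪)` whose reduction mod `𝓂` lies in the standard
parabolic `P_c(𝓀)` (block upper triangular).  For `c = id` this is the Iwahori subgroup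
(`iwahoriGL`), for `c` constant it is `K₀`.
(Iwahori–Matsumoto 1965, §2, for the Borel case; the parabolic case is the standard
generalisation.) [folklore] -/
noncomputable def parahoricGL : Subgroup (GL (Fin n) F) :=
  ((standardParabolicGL 𝓀[F] c).comap (glIntReduction n F)).map (glInt n F).subtype

/-- The **pro-unipotent radical** of the standard parahoric: the elements of `K₀` whose reduction
mod `𝓂` lies in the unipotent radical `U_c(𝓀)` of `P_c(𝓀)`.  For `c = id` this is the
pro-`p` Iwahori subgroup (`proPIwahoriGL`), for `c` constant the first congruence subgroup
`1 + 𝓂 M_n(𝒪)` (the kernel of reduction). [folklore] -/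
noncomputable def proUnipotentGL : Subgroup (GL (Fin n) F) :=
  ((unipotentRadicalGL 𝓀[F] c).comap (glIntReduction n F)).map (glInt n F).subtype

/-- A parahoric subgroup is contained in `K₀ = GL_n(𝒪)`. [folklore] -/
theorem parahoricGL_le_glInt : parahoricGL n F c ≤ glInt n F := Subgroup.map_subtype_le _

/-- The pro-unipotent radical is contained in the parahoric. [folklore] -/
theorem proUnipotentGL_le_parahoricGL : proUnipotentGL n F c ≤ parahoricGL n F c := by
  unfold proUnipotentGL parahoricGL
  exact Subgroup.map_mono (Subgroup.comap_mono (unipotentRadicalGL_le 𝓀[F] c))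

/-- The pro-unipotent radical is contained in `K₀`. [folklore] -/
theorem proUnipotentGL_le_glInt : proUnipotentGL n F c ≤ glInt n F := Subgroup.map_subtype_le _

variable {n F c} in
/-- Membership in the parahoric via the reduction map. [folklore] -/
theorem mem_parahoricGL_iff_reduction (g : GL (Fin n) F) :
    g ∈ parahoricGL n F c ↔
      ∃ hg : g ∈ glInt n F, glIntReduction n F ⟨g, hg⟩ ∈ standardParabolicGL 𝓀[F] c := by
  rw [parahoricGL, Subgroup.mem_map]
  constructor
  · rintro ⟨g', hg', rfl⟩
    exact ⟨g'.2, hg'⟩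
  · rintro ⟨hg, h⟩
    exact ⟨⟨g, hg⟩, h, rfl⟩

variable {n F c} in
/-- Membership in the pro-unipotent radical via the reduction map. [folklore] -/
theorem mem_proUnipotentGL_iff_reduction (g : GL (Fin n) F) :
    g ∈ proUnipotentGL n F c ↔
      ∃ hg : g ∈ glInt n F, glIntReduction n F ⟨g, hg⟩ ∈ unipotentRadicalGL 𝓀[F] c := by
  rw [proUnipotentGL, Subgroup.mem_map]
  constructor
  · rintro ⟨g', hg', rfl⟩
    exact ⟨g'.2, hg'⟩
  · rintro ⟨hg, h⟩
    exact ⟨⟨g, hg⟩, h, rfl⟩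

variable {n F c} in
/-- **Membership in the standard parahoric**: `g ∈ GL_n(𝒪)` and the entries `g i j` below the
block diagonal (`c j < c i`) lie in `𝓂`, i.e. have valuation `< 1`. [folklore] -/
theorem mem_parahoricGL_iff (g : GL (Fin n) F) :
    g ∈ parahoricGL n F c ↔ g ∈ glInt n F ∧
      ∀ i j, c j < c i → valuation F ((g : Matrix (Fin n) (Fin n) F) i j) < 1 := by
  rw [mem_parahoricGL_iff_reduction]
  constructor
  · rintro ⟨hg, h⟩
    refine ⟨hg, fun i j hij => ?_⟩
    rw [mem_standardParabolicGL_iff] at h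
    exact (glIntReduction_apply_eq_zero_iff ⟨g, hg⟩ i j).1 (h hij)
  · rintro ⟨hg, h⟩
    refine ⟨hg, ?_⟩
    rw [mem_standardParabolicGL_iff]
    intro i j hij
    exact (glIntReduction_apply_eq_zero_iff ⟨g, hg⟩ i j).2 (h i j hij)

variable {n F c} in
/-- **Membership in the pro-unipotent radical**: `g ∈ GL_n(𝒪)`, the entries below the block
diagonal lie in `𝓂`, and the diagonal blocks are `≡ 1 mod 𝓂`. [folklore] -/
theorem mem_proUnipotentGL_iff (g : GL (Fin n) F) :
    g ∈ proUnipotentGL n F c ↔ g ∈ glInt n F ∧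
      (∀ i j, c j < c i → valuation F ((g : Matrix (Fin n) (Fin n) F) i j) < 1) ∧
      ∀ i j, c i = c j →
        valuation F ((g : Matrix (Fin n) (Fin n) F) i j - if i = j then 1 else 0) < 1 := by
  rw [mem_proUnipotentGL_iff_reduction]
  constructor
  · rintro ⟨hg, h⟩
    rw [mem_unipotentRadicalGL_iff] at h
    refine ⟨hg, fun i j hij => (glIntReduction_apply_eq_zero_iff ⟨g, hg⟩ i j).1 (h.1 hij),
      fun i j hij => ?_⟩
    have hb := congrFun (congrFun (h.2 (c j)) ⟨i, hij⟩) ⟨j, rfl⟩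
    simp only [Matrix.toSquareBlock_def, Matrix.one_apply, Subtype.mk.injEq] at hb
    split_ifs with heq
    · subst heq
      rw [if_pos rfl] at hb
      exact (glIntReduction_apply_eq_one_iff ⟨g, hg⟩ i i).1 hb
    · rw [if_neg heq] at hb
      rw [sub_zero]
      exact (glIntReduction_apply_eq_zero_iff ⟨g, hg⟩ i j).1 hb
  · rintro ⟨hg, h, h'⟩
    refine ⟨hg, ?_⟩
    rw [mem_unipotentRadicalGL_iff]
    refine ⟨fun i j hij => (glIntReduction_apply_eq_zero_iff ⟨g, hg⟩ i j).2 (h i j hij),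
      fun a => ?_⟩
    ext ⟨i, hi⟩ ⟨j, hj⟩
    simp only [Matrix.toSquareBlock_def, Matrix.one_apply, Subtype.mk.injEq]
    have hij : c i = c j := hi.trans hj.symm
    have := h' i j hij
    split_ifs with heq
    · subst heq
      rw [if_pos rfl] at this
      exact (glIntReduction_apply_eq_one_iff ⟨g, hg⟩ i i).2 this
    · rw [if_neg heq, sub_zero] at this
      exact (glIntReduction_apply_eq_zero_iff ⟨g, hg⟩ i j).2 this

/-- `U_c(R)` is normalised by `P_c(R)` (it is the image of the kernel of the Levi projection). [folklore] -/
theorem standardParabolicGL_le_normalizer_unipotentRadicalGL (R : Type*) [CommRing R] :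
    standardParabolicGL R c ≤ Subgroup.normalizer (unipotentRadicalGL R c : Set (GL (Fin n) R)) :=
  (Subgroup.normal_subgroupOf_iff_le_normalizer (unipotentRadicalGL_le R c)).1
    (by rw [unipotentRadicalGL_subgroupOf]; infer_instance)

/-- The pro-unipotent radical is normal in the parahoric (it is the preimage of the normal subgroup
`U_c(𝓀) ⊴ P_c(𝓀)`). [folklore] -/
theorem proUnipotentGL_normal_subgroupOf :
    ((proUnipotentGL n F c).subgroupOf (parahoricGL n F c)).Normal := by
  rw [Subgroup.normal_subgroupOf_iff_le_normalizer (proUnipotentGL_le_parahoricGL n F c)]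
  rintro g hg
  rw [mem_parahoricGL_iff_reduction] at hg
  obtain ⟨hgK, hgP⟩ := hg
  have hle := standardParabolicGL_le_normalizer_unipotentRadicalGL n c 𝓀[F] hgP
  rw [Subgroup.mem_normalizer_iff] at hle
  rw [Subgroup.mem_normalizer_iff]
  intro h
  constructor
  · intro hh
    rw [mem_proUnipotentGL_iff_reduction] at hh ⊢
    obtain ⟨hhK, hhU⟩ := hh
    have hmem : g * h * g⁻¹ ∈ glInt n F :=
      Subgroup.mul_mem _ (Subgroup.mul_mem _ hgK hhK) (Subgroup.inv_mem _ hgK)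
    refine ⟨hmem, ?_⟩
    have := (hle (glIntReduction n F ⟨h, hhK⟩)).1 hhU
    have e : (⟨g * h * g⁻¹, hmem⟩ : glInt n F) = ⟨g, hgK⟩ * ⟨h, hhK⟩ * ⟨g, hgK⟩⁻¹ := rfl
    rw [e, map_mul, map_mul, map_inv]
    exact this
  · intro hh
    rw [mem_proUnipotentGL_iff_reduction] at hh ⊢
    obtain ⟨hhK, hhU⟩ := hh
    have hmem : h ∈ glInt n F := by
      have : g⁻¹ * (g * h * g⁻¹) * g ∈ glInt n F :=
        Subgroup.mul_mem _ (Subgroup.mul_mem _ (Subgroup.inv_mem _ hgK) hhK) hgK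
      simpa [mul_assoc] using this
    refine ⟨hmem, ?_⟩
    refine (hle (glIntReduction n F ⟨h, hmem⟩)).2 ?_
    have e : (⟨g, hgK⟩ * ⟨h, hmem⟩ * ⟨g, hgK⟩⁻¹ : glInt n F) = ⟨g * h * g⁻¹, hhK⟩ := rfl
    rw [← map_inv, ← map_mul, ← map_mul, e]
    exact hhU

end Parahoric

/-! ### The Iwahori and pro-`p` Iwahori subgroups -/

section Iwahori

variable (n : ℕ) (F : Type u) [Field F] [ValuativeRel F]

/-- The (standard) **Iwahori subgroup** `I ≤ GL_n(F)`: matrices in `GL_n(𝒪)` which are upper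
triangular modulo `𝓂` (the standard parahoric of the labelling `id`: the inverse image of the
Borel `B(𝓀)` under reduction mod `𝓂`, which is Iwahori–Matsumoto's characterisation of their
`B`, Prop. 2.4/Thm. 2.5). (Iwahori–Matsumoto 1965, §2; Breuil ICM 2010, §3.2.) [cite: IwahoriMatsumoto1965, §2 Prop. 2.4] -/
noncomputable abbrev iwahoriGL : Subgroup (GL (Fin n) F) := parahoricGL n F (id : Fin n → Fin n)

/-- The **pro-`p` Iwahori subgroup** `I₁ ≤ I`: matrices in `GL_n(𝒪)` which are upper
unitriangular modulo `𝓂` (inverse image of `U(𝓀)`; when `𝓀` is finite of characteristic `p` it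
is the pro-`p` Sylow subgroup of `I`, `I/I₁ ≅ (𝓀^×)^n` having order prime to `p`).
(Breuil ICM 2010, §3.2, "the pro-`p` subgroup `I₁` of `I`".) [cite: Breuil2011, §3.2] -/
noncomputable abbrev proPIwahoriGL : Subgroup (GL (Fin n) F) :=
  proUnipotentGL n F (id : Fin n → Fin n)

/-- The **normalizer `N(F)` of the Iwahori subgroup** in `GL_n(F)` (for `n = 2`: "generated by
`I`, the scalars `F^×` and the matrix `(0 1; ϖ_F 0)`", Breuil ICM 2010, §3.2; only the definition
as a normalizer is used here). [cite: Breuil2011, §3.2] -/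
noncomputable abbrev iwahoriNormalizerGL : Subgroup (GL (Fin n) F) :=
  Subgroup.normalizer (iwahoriGL n F : Set (GL (Fin n) F))

variable {n F} in
/-- **Membership in the Iwahori subgroup**: `g ∈ GL_n(𝒪)` and the entries strictly below the
diagonal have valuation `< 1`. [folklore] -/
theorem mem_iwahoriGL_iff (g : GL (Fin n) F) :
    g ∈ iwahoriGL n F ↔ g ∈ glInt n F ∧
      ∀ i j : Fin n, j < i → valuation F ((g : Matrix (Fin n) (Fin n) F) i j) < 1 :=
  mem_parahoricGL_iff g

variable {n F} in
/-- **Membership in the pro-`p` Iwahori subgroup**: `g ∈ GL_n(𝒪)`, the entries strictly below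
the diagonal have valuation `< 1`, and the diagonal entries are `≡ 1 mod 𝓂`. [folklore] -/
theorem mem_proPIwahoriGL_iff (g : GL (Fin n) F) :
    g ∈ proPIwahoriGL n F ↔ g ∈ glInt n F ∧
      (∀ i j : Fin n, j < i → valuation F ((g : Matrix (Fin n) (Fin n) F) i j) < 1) ∧
      ∀ i : Fin n, valuation F ((g : Matrix (Fin n) (Fin n) F) i i - 1) < 1 := by
  rw [proPIwahoriGL, mem_proUnipotentGL_iff]
  refine and_congr_right fun _ => and_congr_right fun _ => ⟨fun h i => ?_, fun h i j hij => ?_⟩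
  · simpa using h i i rfl
  · obtain rfl : i = j := hij
    simpa using h i

/-- `I₁ ≤ I`. [folklore] -/
theorem proPIwahoriGL_le_iwahoriGL : proPIwahoriGL n F ≤ iwahoriGL n F :=
  proUnipotentGL_le_parahoricGL n F id

/-- `I ≤ K₀ = GL_n(𝒪)`. [folklore] -/
theorem iwahoriGL_le_glInt : iwahoriGL n F ≤ glInt n F := parahoricGL_le_glInt n F id

/-- `I ≤ N(F)`. [folklore] -/
theorem iwahoriGL_le_iwahoriNormalizerGL : iwahoriGL n F ≤ iwahoriNormalizerGL n F :=
  Subgroup.le_normalizer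

/-- The centre of `GL_n(F)` normalizes `I`: `Z ≤ N(F)`. [folklore] -/
theorem center_le_iwahoriNormalizerGL :
    Subgroup.center (GL (Fin n) F) ≤ iwahoriNormalizerGL n F :=
  Subgroup.center_le_normalizer _

/-- `I₁` is normal in `I`. [folklore] -/
theorem proPIwahoriGL_normal_subgroupOf :
    ((proPIwahoriGL n F).subgroupOf (iwahoriGL n F)).Normal :=
  proUnipotentGL_normal_subgroupOf n F id

end Iwahori

/-! ### Topology: parahorics are compact open -/

section Topology

variable (n : ℕ) (F : Type u) [Field F] [ValuativeRel F] [TopologicalSpace F]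
  [IsNonarchimedeanLocalField F] {α : Type*} [LinearOrder α] (c : Fin n → α)

/-- The open unit ball `𝓂 = {x | v x < 1}` is open in `F`. [folklore] -/
theorem isOpen_setOf_valuation_lt_one : IsOpen {x : F | valuation F x < 1} := by
  have h := Valuation.isOpen_ball (v := valuation F) 1
  simp only [Valuation.restrict_lt_one_iff] at h
  exact h

/-- A standard parahoric subgroup of `GL_n` of a non-archimedean local field is open. [folklore] -/
theorem isOpen_parahoricGL : IsOpen (parahoricGL n F c : Set (GL (Fin n) F)) := by
  have h : (parahoricGL n F c : Set (GL (Fin n) F)) = (glInt n F : Set (GL (Fin n) F)) ∩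
      ⋂ i, ⋂ j, {g : GL (Fin n) F |
        c j < c i → valuation F ((g : Matrix (Fin n) (Fin n) F) i j) < 1} := by
    ext g
    simp only [SetLike.mem_coe, mem_parahoricGL_iff, Set.mem_inter_iff, Set.mem_iInter,
      Set.mem_setOf_eq]
  rw [h]
  refine (isOpen_glInt n F).inter
    (isOpen_iInter_of_finite fun i => isOpen_iInter_of_finite fun j => ?_)
  by_cases hij : c j < c i
  · simp only [hij, forall_const]
    exact (isOpen_setOf_valuation_lt_one F).preimage (Units.continuous_val.matrix_elem i j)
  · simp [hij]

/-- The pro-unipotent radical of a standard parahoric is open. [folklore] -/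
theorem isOpen_proUnipotentGL : IsOpen (proUnipotentGL n F c : Set (GL (Fin n) F)) := by
  have h : (proUnipotentGL n F c : Set (GL (Fin n) F)) = (glInt n F : Set (GL (Fin n) F)) ∩
      ((⋂ i, ⋂ j, {g : GL (Fin n) F |
        c j < c i → valuation F ((g : Matrix (Fin n) (Fin n) F) i j) < 1}) ∩
      ⋂ i, ⋂ j, {g : GL (Fin n) F | c i = c j →
        valuation F ((g : Matrix (Fin n) (Fin n) F) i j - if i = j then 1 else 0) < 1}) := by
    ext g
    simp only [SetLike.mem_coe, mem_proUnipotentGL_iff, Set.mem_inter_iff, Set.mem_iInter,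
      Set.mem_setOf_eq]
  rw [h]
  refine (isOpen_glInt n F).inter (IsOpen.inter
    (isOpen_iInter_of_finite fun i => isOpen_iInter_of_finite fun j => ?_)
    (isOpen_iInter_of_finite fun i => isOpen_iInter_of_finite fun j => ?_))
  · by_cases hij : c j < c i
    · simp only [hij, forall_const]
      exact (isOpen_setOf_valuation_lt_one F).preimage (Units.continuous_val.matrix_elem i j)
    · simp [hij]
  · by_cases hij : c i = c j
    · simp only [hij, forall_const]
      exact (isOpen_setOf_valuation_lt_one F).preimage
        ((Units.continuous_val.matrix_elem i j).sub continuous_const)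
    · simp [hij]

/-- A standard parahoric subgroup is compact (a closed — because open — subgroup of the compact
group `GL_n(𝒪)`). [folklore] -/
theorem isCompact_parahoricGL : IsCompact (parahoricGL n F c : Set (GL (Fin n) F)) :=
  (isCompact_glInt n F).of_isClosed_subset
    (Subgroup.isClosed_of_isOpen _ (isOpen_parahoricGL n F c)) (parahoricGL_le_glInt n F c)

/-- The pro-unipotent radical of a standard parahoric is compact. [folklore] -/
theorem isCompact_proUnipotentGL : IsCompact (proUnipotentGL n F c : Set (GL (Fin n) F)) :=
  (isCompact_glInt n F).of_isClosed_subset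
    (Subgroup.isClosed_of_isOpen _ (isOpen_proUnipotentGL n F c)) (proUnipotentGL_le_glInt n F c)

/-- The Iwahori subgroup is open. [folklore] -/
theorem isOpen_iwahoriGL : IsOpen (iwahoriGL n F : Set (GL (Fin n) F)) := isOpen_parahoricGL n F id

/-- The Iwahori subgroup is compact. [folklore] -/
theorem isCompact_iwahoriGL : IsCompact (iwahoriGL n F : Set (GL (Fin n) F)) :=
  isCompact_parahoricGL n F id

/-- The pro-`p` Iwahori subgroup is open. [folklore] -/
theorem isOpen_proPIwahoriGL : IsOpen (proPIwahoriGL n F : Set (GL (Fin n) F)) :=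
  isOpen_proUnipotentGL n F id

/-- The pro-`p` Iwahori subgroup is compact. [folklore] -/
theorem isCompact_proPIwahoriGL : IsCompact (proPIwahoriGL n F : Set (GL (Fin n) F)) :=
  isCompact_proUnipotentGL n F id

/-- The normalizer `N(F)` of the Iwahori subgroup is open (it contains `I`). [folklore] -/
theorem isOpen_iwahoriNormalizerGL : IsOpen (iwahoriNormalizerGL n F : Set (GL (Fin n) F)) :=
  Subgroup.isOpen_mono (iwahoriGL_le_iwahoriNormalizerGL n F) (isOpen_iwahoriGL n F)

end Topology

end Literature.NumberTheory.Automorphic
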